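import Summits.Ventures.MM22.Rank333.Wang333TopCerts
import Summits.Ventures.MM22.Rank333.Root21Of480
import Summits.Ventures.MM22.Rank333.Root21Of480LP
import HarnessLib

/-!
# MM22 venture — «ROOT ⟸ 480»: the printed codimension-1 bounds discharged by the kernel

HONEST FRAMING (cell `pub-mm22`, seat bench g5; v4 item (0), kernel form). The cell's kernel chain for Wang's
`20 ≤ R_{𝔽₂}(⟨3,3,3⟩)` (`Wang333LPCert.lean`, seat p3) and its top-layer export (`Wang333TopCerts.lean`, seat p3:
`cert_codim1_1 : Cert 3 3 3 [1] 19`, `cert_codim1_10 : Cert 3 3 3 [10] 19`, `cert_codim1_84 : Cert 3 3 3 [84] 19` —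
Wang's PRINTED codimension-1 values, now unconditional kernel statements) discharge the hypotheses `h492`, `h493` of
`rankGe21F2_of_480` (`Root21Of480.lean`) and `h492`, `h493`, `h494` of `rankGe21F2_of_480_lp` (`Root21Of480LP.lean`).
What remains CONDITIONAL: orbit 480 at 19 (OPEN) and the cell's LIFTED plane/point bounds (referee-passed exact LP / LP-DFS
certificates, NOT kernel-replayed): seven hypotheses resp. nine. This file proves no bound on `⟨3,3,3⟩`; `RankGe21F2` stays open.
-/

namespace Summit.Ventures.MM22.GF2Cert.Root21

open Summit.MatrixMultiplication.OmegaCensus.GF2RankLB Literature.Computability.AlgebraicComplexity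
open Summit.Ventures.MM22.GF2Cert Summit.Ventures.MM22 Summit.Ventures.MM22.GF2Cert.Top333

/-- **«ROOT ⟸ 480», seven-hypothesis form** (CONDITIONAL): orbit 480 at 19 (OPEN) and the cell's six lifted orbit bounds
(479, 484, 486, 488, 489 at 19; 494 at 20 — exact LP / LP-DFS certificates, not kernel-replayed) imply `21 ≤ R_{𝔽₂}(⟨3,3,3⟩)`;
the printed codimension-1 bounds 492/493 come from the kernel (`Top333.cert_codim1_1`, `Top333.cert_codim1_10`). -/
theorem rankGe21F2_of_480_of_lifts
    (h480 : Cert 3 3 3 [1, 16] 19) (h479 : Cert 3 3 3 [1, 10] 19) (h484 : Cert 3 3 3 [10, 19] 19)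
    (h486 : Cert 3 3 3 [10, 68] 19) (h488 : Cert 3 3 3 [10, 96] 19) (h489 : Cert 3 3 3 [10, 258] 19)
    (h494 : Cert 3 3 3 [84] 20) : RankGe21F2 :=
  rankGe21F2_of_480 h480 h479 h484 h486 h488 h489 cert_codim1_1 cert_codim1_10 h494

/-- **«ROOT ⟸ 480», LP variant, nine-hypothesis form** (CONDITIONAL): orbit 480 at 19 (OPEN) and the cell's eight lifted
PLANE bounds 479, 484, 486, 488, 489, 487, 490, 491 at 19 (exact LP / LP-DFS certificates with small leaf counts, not
kernel-replayed) imply `21 ≤ R_{𝔽₂}(⟨3,3,3⟩)`; the printed point bounds 492/493/494 at 19 come from the kernel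
(`Top333.cert_codim1_1`, `cert_codim1_10`, `cert_codim1_84`). No lifted point bound (no `494 @ 20`) is used. -/
theorem rankGe21F2_of_480_lp_of_lifts
    (h480 : Cert 3 3 3 [1, 16] 19) (h479 : Cert 3 3 3 [1, 10] 19) (h484 : Cert 3 3 3 [10, 19] 19)
    (h486 : Cert 3 3 3 [10, 68] 19) (h488 : Cert 3 3 3 [10, 96] 19) (h489 : Cert 3 3 3 [10, 258] 19)
    (h487 : Cert 3 3 3 [10, 84] 19) (h490 : Cert 3 3 3 [10, 275] 19) (h491 : Cert 3 3 3 [84, 163] 19) : RankGe21F2 :=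
  LP.rankGe21F2_of_480_lp h480 h479 h484 h486 h488 h489 h487 h490 h491 cert_codim1_1 cert_codim1_10 cert_codim1_84

end Summit.Ventures.MM22.GF2Cert.Root21
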